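import Mathlib.Analysis.InnerProductSpace.PiL2
import Mathlib.Analysis.Calculus.ContDiff.FiniteDimension
import Mathlib.Analysis.Calculus.ContDiff.Basic
import Literature.Analysis.Calculus.MultilinearComponentBounds
import Literature.Analysis.FunctionSpaces.HolderOnSetToolkit
import Literature.Analysis.PDE.EllipticSmoothBootstrapData
import HarnessLib

/-!
# `C^{n,α}` data on open sets and balls: lowering, directional derivatives, pairs, pi, reassembly

Topic `Literature/Analysis/FunctionSpaces`.  Bookkeeping for the "`C^{n,α}` data" of a map
`f : E → F` on a set `s` in the unbundled form used by the interior regularity theory of elliptic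
equations in this tree (Gilbarg–Trudinger 2001, §6.1, §17.4):

  `ContDiffOn ℝ n f s ∧ ∃ B, (∀ y ∈ s, ∀ j ≤ n, ‖Dʲf(y)‖ ≤ B) ∧ [Dⁿf]_{α; s} ≤ B`

(`HolderOnWith B α (iteratedFDeriv ℝ n f) s`).  Everything here is elementary calculus:

* `holderOnWith_iteratedFDeriv_of_lt`, `holderBallData_of_le` — on a ball, a bound of
  `D^{j+1}f` makes `Dʲf` Hölder (mean value inequality,
  `Literature.Analysis.FunctionSpaces.holderOnWith_of_norm_fderiv_le_ball`), so `C^{N,α}` data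
  give `C^{n,α}` data for `n ≤ N`;
* `holderData_congr` — invariance under modification off the open set;
* `iteratedFDeriv_fderiv_apply_vector_eq_snoc` and the norm estimates
  `norm_iteratedFDeriv_fderiv_apply_vector_le`, `norm_iteratedFDeriv_fderiv_apply_vector_sub_le`:
  `Dʲ(z ↦ Df(z) e)(y)(w) = D^{j+1}f(y)(w, e)` (the vector-valued version of
  `Literature.Analysis.Calculus.iteratedFDeriv_fderiv_apply_eq_snoc`), whence
  `holderData_fderiv_apply_vector`: `C^{n+1,α}` data of `f` give `C^{n,α}` data of every
  directional derivative `z ↦ Df(z) e`, `‖e‖ ≤ 1`, with the same constant;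
* `holderData_iteratedFDeriv_apply` — the same for the components `y ↦ Dʲf(y)(M)` of an
  iterated derivative (`C^{n+j,α} ⇒ C^{n,α}`);
* `holderData_prodMk`, `holderData_pi` — pairs and finite products (sup norms);
* `contDiffOn_succ_of_fderiv_apply_basis`, `norm_iteratedFDeriv_succ_le_of_fderiv_apply_basis`,
  `holderOnWith_iteratedFDeriv_succ_of_fderiv_apply_basis`, `holderData_succ_of_basis` — the
  converse direction along an orthonormal basis `(e_k)`: `D^{n+1}u` is reassembled from the
  `Dⁿ(∂_{e_k} u)` (components `D^{n+1}u(e_I) = Dⁿ(∂_{e_{I last}})u(e_{init I})`,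
  `Literature/Analysis/Calculus/MultilinearComponentBounds.lean`).

Everything is proved; no definitions, no named facts.  Not here: coordinate jets (see
`Literature/Analysis/PDE/EllipticDifferentiatedProblem.lean`) and anything about equations.

## References

* D. Gilbarg, N. S. Trudinger, *Elliptic Partial Differential Equations of Second Order*,
  Classics in Mathematics, Springer 2001, §4.1, §6.1, §17.4. [GilbargTrudinger2001]
* J. Dieudonné, *Foundations of Modern Analysis*, Academic Press 1960, Ch. VIII §12.
  [Dieudonne1960]
-/

noncomputable section

open Function Metric Set Filter
open scoped NNReal ENNReal ContDiff Topology InnerProductSpace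
open Literature.Analysis.PDE (holderOnWith_of_norm_sub_le_norm_sub holderOnWith_congr_on)

namespace Literature.Analysis.FunctionSpaces

section General

variable {E F G : Type*} [NormedAddCommGroup E] [NormedSpace ℝ E] [NormedAddCommGroup F]
  [NormedSpace ℝ F] [NormedAddCommGroup G] [NormedSpace ℝ G]

/-! ### Lowering the order on a ball -/

/-- On a ball, a bound `‖D^{j+1}f‖ ≤ B` for a `C^N` map, `j < N`, makes `Dʲf` `α`-Hölder
(`α ≤ 1`) with constant `B (2r)^{1-α}` (mean value inequality on the convex ball). [folklore] -/
theorem holderOnWith_iteratedFDeriv_of_lt {f : E → F} {x₀ : E} {r : ℝ} {N j : ℕ}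
    (hf : ContDiffOn ℝ N f (ball x₀ r)) (hj : j < N) {B : ℝ≥0}
    (hB : ∀ y ∈ ball x₀ r, ‖iteratedFDeriv ℝ (j + 1) f y‖ ≤ B) {α : ℝ≥0} (hα : α ≤ 1) :
    HolderOnWith (B * (2 * r.toNNReal) ^ (1 - (α : ℝ))) α (iteratedFDeriv ℝ j f) (ball x₀ r) := by
  refine holderOnWith_of_norm_fderiv_le_ball hα (fun z hz => ?_) (fun z hz => ?_)
  · have hfz : ContDiffAt ℝ N f z := hf.contDiffAt (isOpen_ball.mem_nhds hz)
    exact (hfz.differentiableAt_iteratedFDeriv (by exact_mod_cast hj)).differentiableWithinAt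
  · rw [norm_fderiv_iteratedFDeriv]
    exact hB z hz

/-- **Lowering the order of `C^{N,α}` data on a ball**: `C^{N,α}` data of `f` on `B(x₀, r)` give
`C^{n,α}` data for every `n ≤ N` (the intermediate derivatives are Hölder by the mean value
inequality; constant `B + B (2r)^{1-α}`). [folklore] -/
theorem holderBallData_of_le {f : E → F} {x₀ : E} {r : ℝ} {N n : ℕ} (hn : n ≤ N) {α : ℝ≥0}
    (hα : α ≤ 1) (hf : ContDiffOn ℝ N f (ball x₀ r))
    (hB : ∃ B : ℝ≥0, (∀ y ∈ ball x₀ r, ∀ j ≤ N, ‖iteratedFDeriv ℝ j f y‖ ≤ B) ∧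
      HolderOnWith B α (iteratedFDeriv ℝ N f) (ball x₀ r)) :
    ContDiffOn ℝ n f (ball x₀ r) ∧ ∃ B : ℝ≥0,
      (∀ y ∈ ball x₀ r, ∀ j ≤ n, ‖iteratedFDeriv ℝ j f y‖ ≤ B) ∧
      HolderOnWith B α (iteratedFDeriv ℝ n f) (ball x₀ r) := by
  obtain ⟨B, hB, hH⟩ := hB
  refine ⟨hf.of_le (by exact_mod_cast hn), B + B * (2 * r.toNNReal) ^ (1 - (α : ℝ)),
    fun y hy j hj => (hB y hy j (hj.trans hn)).trans ?_, ?_⟩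
  · exact_mod_cast le_self_add
  · rcases hn.lt_or_eq with hlt | rfl
    · exact (holderOnWith_iteratedFDeriv_of_lt hf hlt (fun y hy => hB y hy (n + 1) hlt)
        hα).mono_const le_add_self
    · exact hH.mono_const le_self_add

/-! ### Modification off the open set -/

/-- `C^{n,α}` data on an open set only depend on the values on the set. [folklore] -/
theorem holderData_congr {f g : E → F} {s : Set E} (hs : IsOpen s)
    (hfg : ∀ y ∈ s, f y = g y) {n : ℕ} {α : ℝ≥0}
    (hf : ContDiffOn ℝ n f s ∧ ∃ B : ℝ≥0, (∀ y ∈ s, ∀ j ≤ n, ‖iteratedFDeriv ℝ j f y‖ ≤ B) ∧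
      HolderOnWith B α (iteratedFDeriv ℝ n f) s) :
    ContDiffOn ℝ n g s ∧ ∃ B : ℝ≥0, (∀ y ∈ s, ∀ j ≤ n, ‖iteratedFDeriv ℝ j g y‖ ≤ B) ∧
      HolderOnWith B α (iteratedFDeriv ℝ n g) s := by
  obtain ⟨hcd, B, hB, hH⟩ := hf
  have heq : ∀ j, ∀ y ∈ s, iteratedFDeriv ℝ j g y = iteratedFDeriv ℝ j f y := fun j y hy =>
    ((Filter.eventuallyEq_of_mem (hs.mem_nhds hy) fun z hz => (hfg z hz).symm).iteratedFDeriv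
      ℝ j).eq_of_nhds
  refine ⟨hcd.congr fun y hy => (hfg y hy).symm, B, fun y hy j hj => (heq j y hy) ▸ hB y hy j hj,
    holderOnWith_congr_on (fun y hy => (heq n y hy).symm) hH⟩

/-! ### Directional derivatives of vector-valued maps -/

/-- `Dʲ(z ↦ Df(z) e)(y)(w) = D^{j+1}f(y)(w, e)` for `f` of class `C^{j+1}` at `y` (vector-valued
version of `Literature.Analysis.Calculus.iteratedFDeriv_fderiv_apply_eq_snoc`: the last slot of
`iteratedFDeriv` is the innermost derivative, and evaluation at `e` is continuous linear).
[folklore] -/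
theorem iteratedFDeriv_fderiv_apply_vector_eq_snoc {f : E → F} {y : E} {j : ℕ}
    (hf : ContDiffAt ℝ (j + 1 : ℕ) f y) (w : Fin j → E) (e : E) :
    iteratedFDeriv ℝ j (fun z => fderiv ℝ f z e) y w =
      iteratedFDeriv ℝ (j + 1) f y (Fin.snoc w e) := by
  rw [iteratedFDeriv_succ_apply_right, Fin.init_snoc, Fin.snoc_last]
  have hf' : ContDiffAt ℝ (j : ℕ) (fderiv ℝ f) y := hf.fderiv_right (by norm_cast)
  have h := ContinuousLinearMap.iteratedFDeriv_comp_left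
    (ContinuousLinearMap.apply ℝ F e) hf' (i := j) le_rfl
  have hcomp : ((ContinuousLinearMap.apply ℝ F e) ∘ fderiv ℝ f) = fun z => fderiv ℝ f z e := by
    funext z
    rfl
  rw [hcomp] at h
  rw [h]
  rfl

/-- `‖Dʲ(z ↦ Df(z) e)(y)‖ ≤ ‖D^{j+1}f(y)‖ ‖e‖`. [folklore] -/
theorem norm_iteratedFDeriv_fderiv_apply_vector_le {f : E → F} {y : E} {j : ℕ}
    (hf : ContDiffAt ℝ (j + 1 : ℕ) f y) (e : E) :
    ‖iteratedFDeriv ℝ j (fun z => fderiv ℝ f z e) y‖ ≤ ‖iteratedFDeriv ℝ (j + 1) f y‖ * ‖e‖ := by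
  refine ContinuousMultilinearMap.opNorm_le_bound (by positivity) fun w => ?_
  rw [iteratedFDeriv_fderiv_apply_vector_eq_snoc hf w e]
  refine ((iteratedFDeriv ℝ (j + 1) f y).le_opNorm _).trans (le_of_eq ?_)
  rw [Fin.prod_univ_castSucc]
  simp only [Fin.snoc_castSucc, Fin.snoc_last]
  ring

/-- `‖Dʲ(z ↦ Df(z) e)(x) - Dʲ(z ↦ Df(z) e)(y)‖ ≤ ‖D^{j+1}f(x) - D^{j+1}f(y)‖ ‖e‖`. [folklore] -/
theorem norm_iteratedFDeriv_fderiv_apply_vector_sub_le {f : E → F} {x y : E} {j : ℕ}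
    (hx : ContDiffAt ℝ (j + 1 : ℕ) f x) (hy : ContDiffAt ℝ (j + 1 : ℕ) f y) (e : E) :
    ‖iteratedFDeriv ℝ j (fun z => fderiv ℝ f z e) x - iteratedFDeriv ℝ j (fun z => fderiv ℝ f z e) y‖
      ≤ ‖iteratedFDeriv ℝ (j + 1) f x - iteratedFDeriv ℝ (j + 1) f y‖ * ‖e‖ := by
  refine ContinuousMultilinearMap.opNorm_le_bound (by positivity) fun w => ?_
  rw [sub_apply, iteratedFDeriv_fderiv_apply_vector_eq_snoc hx w e,
    iteratedFDeriv_fderiv_apply_vector_eq_snoc hy w e, ← sub_apply]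
  refine (ContinuousMultilinearMap.le_opNorm _ _).trans (le_of_eq ?_)
  rw [Fin.prod_univ_castSucc]
  simp only [Fin.snoc_castSucc, Fin.snoc_last]
  ring

/-- **`C^{n+1,α}` data of `f` give `C^{n,α}` data of a directional derivative `z ↦ Df(z) e`**,
`‖e‖ ≤ 1`, on an open set, with the same constant. [folklore] -/
theorem holderData_fderiv_apply_vector {f : E → F} {s : Set E} (hs : IsOpen s) {n : ℕ}
    {α : ℝ≥0} {e : E} (he : ‖e‖ ≤ 1) (hf : ContDiffOn ℝ (n + 1 : ℕ) f s)
    (hB : ∃ B : ℝ≥0, (∀ y ∈ s, ∀ j ≤ n + 1, ‖iteratedFDeriv ℝ j f y‖ ≤ B) ∧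
      HolderOnWith B α (iteratedFDeriv ℝ (n + 1) f) s) :
    ContDiffOn ℝ n (fun z => fderiv ℝ f z e) s ∧ ∃ B : ℝ≥0,
      (∀ y ∈ s, ∀ j ≤ n, ‖iteratedFDeriv ℝ j (fun z => fderiv ℝ f z e) y‖ ≤ B) ∧
      HolderOnWith B α (iteratedFDeriv ℝ n (fun z => fderiv ℝ f z e)) s := by
  obtain ⟨B, hB, hH⟩ := hB
  have hat : ∀ y ∈ s, ∀ j ≤ n, ContDiffAt ℝ (j + 1 : ℕ) f y := fun y hy j hj =>
    (hf.contDiffAt (hs.mem_nhds hy)).of_le (by exact_mod_cast Nat.succ_le_succ hj)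
  refine ⟨(hf.fderiv_of_isOpen hs (by norm_cast)).clm_apply contDiffOn_const, B,
    fun y hy j hj => ?_, ?_⟩
  · calc ‖iteratedFDeriv ℝ j (fun z => fderiv ℝ f z e) y‖
          ≤ ‖iteratedFDeriv ℝ (j + 1) f y‖ * ‖e‖ :=
            norm_iteratedFDeriv_fderiv_apply_vector_le (hat y hy j hj) e
      _ ≤ B * 1 := mul_le_mul (hB y hy (j + 1) (Nat.succ_le_succ hj)) he (norm_nonneg _)
            B.coe_nonneg
      _ = B := mul_one _
  · refine holderOnWith_of_norm_sub_le_norm_sub (fun x hx y hy => ?_) hH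
    calc ‖iteratedFDeriv ℝ n (fun z => fderiv ℝ f z e) x
            - iteratedFDeriv ℝ n (fun z => fderiv ℝ f z e) y‖
          ≤ ‖iteratedFDeriv ℝ (n + 1) f x - iteratedFDeriv ℝ (n + 1) f y‖ * ‖e‖ :=
            norm_iteratedFDeriv_fderiv_apply_vector_sub_le (hat x hx n le_rfl) (hat y hy n le_rfl) e
      _ ≤ ‖iteratedFDeriv ℝ (n + 1) f x - iteratedFDeriv ℝ (n + 1) f y‖ :=
            mul_le_of_le_one_right (norm_nonneg _) he

/-- **`C^{n+j,α}` data of `f` give `C^{n,α}` data of the components `y ↦ Dʲf(y)(M)`** of the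
`j`-th derivative, for a tuple `M` of vectors of norm `≤ 1`, on an open set, with the same
constant (iterate `holderData_fderiv_apply_vector`: `D^{j+1}f(y)(M) = Dʲ(∂_{M last} f)(y)(init M)`).
[folklore] -/
theorem holderData_iteratedFDeriv_apply {s : Set E} (hs : IsOpen s) {α : ℝ≥0} (j : ℕ) :
    ∀ {n : ℕ} {f : E → F} (M : Fin j → E), (∀ t, ‖M t‖ ≤ 1) → ContDiffOn ℝ (n + j : ℕ) f s →
      (∃ B : ℝ≥0, (∀ y ∈ s, ∀ i ≤ n + j, ‖iteratedFDeriv ℝ i f y‖ ≤ B) ∧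
        HolderOnWith B α (iteratedFDeriv ℝ (n + j) f) s) →
      ContDiffOn ℝ n (fun y => iteratedFDeriv ℝ j f y M) s ∧ ∃ B : ℝ≥0,
        (∀ y ∈ s, ∀ i ≤ n, ‖iteratedFDeriv ℝ i (fun y => iteratedFDeriv ℝ j f y M) y‖ ≤ B) ∧
        HolderOnWith B α (iteratedFDeriv ℝ n (fun y => iteratedFDeriv ℝ j f y M)) s := by
  induction j with
  | zero =>
      intro n f M hM hf hB
      have hfun : (fun y => iteratedFDeriv ℝ 0 f y M) = f := funext fun y => iteratedFDeriv_zero_apply M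
      rw [hfun]
      exact ⟨hf, hB⟩
  | succ j ih =>
      intro n f M hM hf hB
      have hf' : ContDiffOn ℝ ((n + j) + 1 : ℕ) f s := hf
      obtain ⟨hg, hgB⟩ := holderData_fderiv_apply_vector hs (hM (Fin.last j)) hf' hB
      have h := ih (Fin.init M) (fun t => hM _) hg hgB
      refine holderData_congr hs (fun y hy => ?_) h
      have hfy : ContDiffAt ℝ (j + 1 : ℕ) f y :=
        (hf.contDiffAt (hs.mem_nhds hy)).of_le (by exact_mod_cast Nat.le_add_left (j + 1) n)
      show iteratedFDeriv ℝ j (fun z => fderiv ℝ f z (M (Fin.last j))) y (Fin.init M) = _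
      rw [iteratedFDeriv_fderiv_apply_vector_eq_snoc hfy, Fin.snoc_init_self]

/-! ### Pairs and finite products -/

/-- **Pairs**: `C^{n,α}` data of `f` and `g` on an open set give `C^{n,α}` data of
`x ↦ (f x, g x)` (sup norm on the product; `Dʲ(f, g) = (Dʲf, Dʲg)`). [folklore] -/
theorem holderData_prodMk {f : E → F} {g : E → G} {s : Set E} (hs : IsOpen s) {n : ℕ}
    {α : ℝ≥0}
    (hf : ContDiffOn ℝ n f s ∧ ∃ B : ℝ≥0, (∀ y ∈ s, ∀ j ≤ n, ‖iteratedFDeriv ℝ j f y‖ ≤ B) ∧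
      HolderOnWith B α (iteratedFDeriv ℝ n f) s)
    (hg : ContDiffOn ℝ n g s ∧ ∃ B : ℝ≥0, (∀ y ∈ s, ∀ j ≤ n, ‖iteratedFDeriv ℝ j g y‖ ≤ B) ∧
      HolderOnWith B α (iteratedFDeriv ℝ n g) s) :
    ContDiffOn ℝ n (fun x => (f x, g x)) s ∧ ∃ B : ℝ≥0,
      (∀ y ∈ s, ∀ j ≤ n, ‖iteratedFDeriv ℝ j (fun x => (f x, g x)) y‖ ≤ B) ∧
      HolderOnWith B α (iteratedFDeriv ℝ n (fun x => (f x, g x))) s := by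
  obtain ⟨hfc, Bf, hBf, hHf⟩ := hf
  obtain ⟨hgc, Bg, hBg, hHg⟩ := hg
  have heq : ∀ y ∈ s, ∀ j ≤ n, iteratedFDeriv ℝ j (fun x => (f x, g x)) y =
      (iteratedFDeriv ℝ j f y).prod (iteratedFDeriv ℝ j g y) := fun y hy j hj =>
    iteratedFDeriv_prodMk (hfc.contDiffAt (hs.mem_nhds hy)) (hgc.contDiffAt (hs.mem_nhds hy))
      (by exact_mod_cast hj)
  refine ⟨hfc.prodMk hgc, max Bf Bg, fun y hy j hj => ?_, ?_⟩
  · rw [heq y hy j hj, ContinuousMultilinearMap.opNorm_prod, NNReal.coe_max]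
    exact max_le_max (hBf y hy j hj) (hBg y hy j hj)
  · refine holderOnWith_of_norm_sub_le_norm_sub (fun x hx y hy => ?_) (HolderOnWith.prodMk hHf hHg)
    rw [heq x hx n le_rfl, heq y hy n le_rfl]
    have hsub : (iteratedFDeriv ℝ n f x).prod (iteratedFDeriv ℝ n g x)
        - (iteratedFDeriv ℝ n f y).prod (iteratedFDeriv ℝ n g y)
        = (iteratedFDeriv ℝ n f x - iteratedFDeriv ℝ n f y).prod
            (iteratedFDeriv ℝ n g x - iteratedFDeriv ℝ n g y) := by
      ext m <;> rfl
    rw [hsub, ContinuousMultilinearMap.opNorm_prod, Prod.norm_def]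
    rfl

/-- **Finite products**: componentwise `C^{n,α}` data of `f : E → Π i, Φ i` on an open set give
`C^{n,α}` data of `f` (sup norm; `(Dʲf) i = Dʲ(f i)`; constant `∑ B_i`). [folklore] -/
theorem holderData_pi {κ : Type*} [Fintype κ] {Φ : κ → Type*}
    [∀ i, NormedAddCommGroup (Φ i)] [∀ i, NormedSpace ℝ (Φ i)] {f : E → Π i, Φ i} {s : Set E}
    (hs : IsOpen s) {n : ℕ} {α : ℝ≥0}
    (h : ∀ i, ContDiffOn ℝ n (fun x => f x i) s ∧ ∃ B : ℝ≥0,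
      (∀ y ∈ s, ∀ j ≤ n, ‖iteratedFDeriv ℝ j (fun x => f x i) y‖ ≤ B) ∧
      HolderOnWith B α (iteratedFDeriv ℝ n (fun x => f x i)) s) :
    ContDiffOn ℝ n f s ∧ ∃ B : ℝ≥0, (∀ y ∈ s, ∀ j ≤ n, ‖iteratedFDeriv ℝ j f y‖ ≤ B) ∧
      HolderOnWith B α (iteratedFDeriv ℝ n f) s := by
  have hcd : ContDiffOn ℝ n f s := contDiffOn_pi.2 fun i => (h i).1
  have h2 := fun i => (h i).2
  choose B hB hH using h2
  have heq : ∀ y ∈ s, ∀ j ≤ n, ∀ (i) (m : Fin j → E),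
      iteratedFDeriv ℝ j f y m i = iteratedFDeriv ℝ j (fun x => f x i) y m := by
    intro y hy j hj i m
    have hc := ContinuousLinearMap.iteratedFDeriv_comp_left
      (ContinuousLinearMap.proj (R := ℝ) (φ := Φ) i) (hcd.contDiffAt (hs.mem_nhds hy)) (i := j)
      (by exact_mod_cast hj)
    have hfun : (⇑(ContinuousLinearMap.proj (R := ℝ) (φ := Φ) i) ∘ f) = fun x => f x i := rfl
    rw [hfun] at hc
    rw [hc]
    rfl
  have hle : ∀ i, B i ≤ ∑ i', B i' := fun i =>
    Finset.single_le_sum (fun _ _ => zero_le) (Finset.mem_univ i)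
  refine ⟨hcd, ∑ i, B i, fun y hy j hj => ?_, ?_⟩
  · refine ContinuousMultilinearMap.opNorm_le_bound (by positivity) fun m => ?_
    refine (pi_norm_le_iff_of_nonneg (by positivity)).2 fun i => ?_
    rw [heq y hy j hj i m]
    refine ((iteratedFDeriv ℝ j (fun x => f x i) y).le_opNorm m).trans ?_
    gcongr
    exact (hB i y hy j hj).trans (NNReal.coe_le_coe.2 (hle i))
  · have hpi : HolderOnWith (∑ i, B i) α
        (fun x => fun i => iteratedFDeriv ℝ n (fun x => f x i) x) s :=
      holderOnWith_pi_iff.2 fun i => (hH i).mono_const (hle i)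
    refine holderOnWith_of_norm_sub_le_norm_sub (fun x hx y hy => ?_) hpi
    refine ContinuousMultilinearMap.opNorm_le_bound (norm_nonneg _) fun m => ?_
    refine (pi_norm_le_iff_of_nonneg (by positivity)).2 fun i => ?_
    rw [sub_apply, Pi.sub_apply, heq x hx n le_rfl i m,
      heq y hy n le_rfl i m, ← sub_apply]
    refine (ContinuousMultilinearMap.le_opNorm _ _).trans ?_
    gcongr
    exact norm_le_pi_norm (fun i => iteratedFDeriv ℝ n (fun x => f x i) x
      - iteratedFDeriv ℝ n (fun x => f x i) y) i

end General

/-! ### Reassembling `D^{n+1}u` from the `Dⁿ` of the directional derivatives along a basis -/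

section Basis

variable {ι : Type*} [Fintype ι] {E : Type*} [NormedAddCommGroup E] [InnerProductSpace ℝ E]
  {F : Type*} [NormedAddCommGroup F] [NormedSpace ℝ F]

/-- A map differentiable on an open set whose directional derivatives along an orthonormal basis
are `Cⁿ` there is `C^{n+1}` there. [folklore] -/
theorem contDiffOn_succ_of_fderiv_apply_basis [FiniteDimensional ℝ E] (bE : OrthonormalBasis ι ℝ E)
    {v : E → F} {s : Set E} (hs : IsOpen s) {n : ℕ} (hv : DifferentiableOn ℝ v s)
    (h : ∀ k, ContDiffOn ℝ n (fun z => fderiv ℝ v z (bE k)) s) :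
    ContDiffOn ℝ (n + 1 : ℕ) v s := by
  rw [Nat.cast_succ]
  refine (contDiffOn_succ_iff_fderiv_of_isOpen hs).2 ⟨hv, fun h' => absurd h' (by simp), ?_⟩
  refine contDiffOn_clm_apply.2 fun w => ?_
  have hw : (fun x => fderiv ℝ v x w) = fun x => ∑ k, ⟪bE k, w⟫_ℝ • fderiv ℝ v x (bE k) := by
    funext x
    conv_lhs => rw [← bE.sum_repr' w]
    simp only [map_sum, map_smul]
  rw [hw]
  exact ContDiffOn.sum fun k _ => (h k).const_smul _

/-- `‖D^{n+1}u(x)‖ ≤ (card ι)^{n+1} B` on an open set when `‖Dⁿ(∂_{e_k}u)(x)‖ ≤ B` there for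
every basis direction (the components `D^{n+1}u(x)(e_I) = Dⁿ(∂_{e_{I last}}u)(x)(e_{init I})`).
[folklore] -/
theorem norm_iteratedFDeriv_succ_le_of_fderiv_apply_basis (bE : OrthonormalBasis ι ℝ E)
    {v : E → ℝ} {s : Set E} (hs : IsOpen s) {n : ℕ} (hv : ContDiffOn ℝ (n + 1 : ℕ) v s) {B : ℝ}
    (h : ∀ k, ∀ x ∈ s, ‖iteratedFDeriv ℝ n (fun z => fderiv ℝ v z (bE k)) x‖ ≤ B) :
    ∀ x ∈ s, ‖iteratedFDeriv ℝ (n + 1) v x‖ ≤ (Fintype.card ι) ^ (n + 1) * B := by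
  refine Literature.Analysis.Calculus.norm_multilinear_le_of_components bE fun I x hx => ?_
  have hvx : ContDiffAt ℝ (n + 1 : ℕ) v x := hv.contDiffAt (hs.mem_nhds hx)
  have hsnoc : (Fin.snoc (fun t : Fin n => bE (I (Fin.castSucc t))) (bE (I (Fin.last n))) :
      Fin (n + 1) → E) = fun t => bE (I t) := Fin.snoc_init_self (fun t => bE (I t))
  have hcomp : iteratedFDeriv ℝ (n + 1) v x (fun t => bE (I t)) =
      iteratedFDeriv ℝ n (fun z => fderiv ℝ v z (bE (I (Fin.last n)))) x
        (fun t => bE (I (Fin.castSucc t))) := by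
    rw [iteratedFDeriv_fderiv_apply_vector_eq_snoc hvx, hsnoc]
  rw [hcomp, ← Real.norm_eq_abs]
  refine ((iteratedFDeriv ℝ n (fun z => fderiv ℝ v z (bE (I (Fin.last n)))) x).le_opNorm
    _).trans ?_
  rw [Finset.prod_eq_one (fun t _ => bE.orthonormal.1 _), mul_one]
  exact h _ x hx

/-- `D^{n+1}u` is `((card ι)^{n+1} C, α)`-Hölder on an open set when every `Dⁿ(∂_{e_k}u)` is
`(C, α)`-Hölder there. [folklore] -/
theorem holderOnWith_iteratedFDeriv_succ_of_fderiv_apply_basis (bE : OrthonormalBasis ι ℝ E)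
    {v : E → ℝ} {s : Set E} (hs : IsOpen s) {n : ℕ} (hv : ContDiffOn ℝ (n + 1 : ℕ) v s)
    {C α : ℝ≥0} (h : ∀ k, HolderOnWith C α (iteratedFDeriv ℝ n (fun z => fderiv ℝ v z (bE k))) s) :
    HolderOnWith ((Fintype.card ι) ^ (n + 1) * C) α (iteratedFDeriv ℝ (n + 1) v) s := by
  refine Literature.Analysis.Calculus.holderOnWith_multilinear_of_components bE fun I => ?_
  have hsnoc : (Fin.snoc (fun t : Fin n => bE (I (Fin.castSucc t))) (bE (I (Fin.last n))) :
      Fin (n + 1) → E) = fun t => bE (I t) := Fin.snoc_init_self (fun t => bE (I t))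
  have hcomp : ∀ x ∈ s, iteratedFDeriv ℝ n (fun z => fderiv ℝ v z (bE (I (Fin.last n)))) x
      (fun t => bE (I (Fin.castSucc t))) = iteratedFDeriv ℝ (n + 1) v x (fun t => bE (I t)) :=
    fun x hx => by
      rw [iteratedFDeriv_fderiv_apply_vector_eq_snoc (hv.contDiffAt (hs.mem_nhds hx)), hsnoc]
  refine holderOnWith_congr_on hcomp
    (holderOnWith_of_norm_sub_le_norm_sub (fun x _ y _ => ?_) (h (I (Fin.last n))))
  rw [← sub_apply]
  refine (ContinuousMultilinearMap.le_opNorm _ _).trans (le_of_eq ?_)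
  rw [Finset.prod_eq_one (fun t _ => bE.orthonormal.1 _), mul_one]

/-- **Reassembly**: `C^{n,α}` data of a scalar `u` (`1 ≤ n`) and of all its directional
derivatives `∂_{e_k}u` along an orthonormal basis, on an open set, give `C^{n+1,α}` data of `u`.
[folklore] -/
theorem holderData_succ_of_basis [FiniteDimensional ℝ E] (bE : OrthonormalBasis ι ℝ E)
    {v : E → ℝ} {s : Set E} (hs : IsOpen s) {n : ℕ} (hn : 1 ≤ n) {α : ℝ≥0}
    (hv : ContDiffOn ℝ n v s ∧ ∃ B : ℝ≥0, (∀ y ∈ s, ∀ j ≤ n, ‖iteratedFDeriv ℝ j v y‖ ≤ B) ∧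
      HolderOnWith B α (iteratedFDeriv ℝ n v) s)
    (hk : ∀ k, ContDiffOn ℝ n (fun z => fderiv ℝ v z (bE k)) s ∧ ∃ B : ℝ≥0,
      (∀ y ∈ s, ∀ j ≤ n, ‖iteratedFDeriv ℝ j (fun z => fderiv ℝ v z (bE k)) y‖ ≤ B) ∧
      HolderOnWith B α (iteratedFDeriv ℝ n (fun z => fderiv ℝ v z (bE k))) s) :
    ContDiffOn ℝ (n + 1 : ℕ) v s ∧ ∃ B : ℝ≥0,
      (∀ y ∈ s, ∀ j ≤ n + 1, ‖iteratedFDeriv ℝ j v y‖ ≤ B) ∧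
      HolderOnWith B α (iteratedFDeriv ℝ (n + 1) v) s := by
  have hk2 := fun k => (hk k).2
  choose Bk hBk hHk using hk2
  obtain ⟨hvc, B, hB, -⟩ := hv
  have hcd : ContDiffOn ℝ (n + 1 : ℕ) v s := contDiffOn_succ_of_fderiv_apply_basis bE hs
    (hvc.differentiableOn (by exact_mod_cast Nat.one_le_iff_ne_zero.1 hn)) fun k => (hk k).1
  have hle : ∀ k, Bk k ≤ ∑ k', Bk k' := fun k =>
    Finset.single_le_sum (fun _ _ => zero_le) (Finset.mem_univ k)
  refine ⟨hcd, B + (Fintype.card ι) ^ (n + 1) * ∑ k, Bk k, fun y hy j hj => ?_, ?_⟩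
  · rcases hj.lt_or_eq with hlt | rfl
    · exact (hB y hy j (Nat.lt_succ_iff.1 hlt)).trans (by exact_mod_cast le_self_add)
    · have h := norm_iteratedFDeriv_succ_le_of_fderiv_apply_basis bE hs hcd
        (B := ((∑ k, Bk k : ℝ≥0) : ℝ))
        (fun k x hx => (hBk k x hx n le_rfl).trans (NNReal.coe_le_coe.2 (hle k))) y hy
      refine h.trans ?_
      push_cast
      nlinarith [B.coe_nonneg]
  · exact (holderOnWith_iteratedFDeriv_succ_of_fderiv_apply_basis bE hs hcd
      (fun k => (hHk k).mono_const (hle k))).mono_const le_add_self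

end Basis

end Literature.Analysis.FunctionSpaces
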